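import Literature.Combinatorics.SimpleGraph.HyperellipticInvolutionOneForms
import HarnessLib

/-!
# The canonical map `e ↦ W(e) = {ω ∈ 𝓗¹(G) : ω(e) = 0}` is injective iff `G` is
# 3-edge-connected (Baker–Norine 2009, Proposition 61 (1) ⇔ (3))

Source (held, read at the page; statements VERBATIM). M. Baker, S. Norine, *Harmonic morphisms
and hyperelliptic graphs*, Int. Math. Res. Not. IMRN 2009 [BakerNorine2009] (held text
`paper:arxiv-0707.1309`, chunk p0020), §5.4: «Let `G` be a 2-edge-connected graph, and let
`𝓗¹(G)` be the space of harmonic 1-forms on `G` […]. We define the canonical map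
`ψ_G : E(G) → ℙ(𝓗¹(G))` by sending an edge `e ∈ E(G)` to the hyperplane
`W(e) := {ω ∈ 𝓗¹(G) : ω(e) = 0}`. Note that the condition `ω(e) = 0` is independent of the
orientation of `e` […]. **Proposition 61.** Let `G` be a 2-edge-connected graph. Then the following
are equivalent: (1) The canonical map `ψ_G : E(G) → ℙ(𝓗¹(G))` is injective. (2) The map
`S^{(2)} : Div_+^2(G) → Jac(G)` is injective. (3) `G` is 3-edge-connected. *Proof.* We already
know by Theorem 7 that (2) ⇔ (3), so it suffices to prove that (1) ⇔ (3). Suppose first that `G`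
is 3-edge-connected, and let `e₁, e₂ ∈ E(G)`. Since `G − {e₁, e₂}` is connected, there is a cycle
`C` containing `e₁` but not `e₂`. The characteristic function `χ_C` of `C` is then a flow belonging
to `W(e₂)` but not `W(e₁)`, from which it follows that `ψ_G` is injective. Conversely, suppose `G`
is not 3-edge-connected. Then there exist edges `e₁, e₂ ∈ E(G)` such that `G − {e₁, e₂}` is
disconnected. It follows that any flow `ω ∈ 𝓗¹(G)` which is non-zero on `e₁` must also be
non-zero on `e₂`. Thus `W(e₁) = W(e₂)`, and `ψ_G` is not injective.»

## What is formalised (vocabulary of `HarmonicOneForms` / `HarmonicOneFormsFlowSpace`: flows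
## `IsGraphFlow G ω` with values in a commutative ring `R`; Mathlib's `G.IsEdgeConnected k`)

* `flowHyperplane G R u v = W(uv)` («independent of the orientation»: `flowHyperplane_comm`);
* `IsGraphFlow.sum_boundary_eq_zero` — the net flow across the boundary of any vertex set is `0`;
* **(3) ⇒ (1)** `exists_isGraphFlow_eq_zero_ne_zero` («a cycle `C` containing `e₁` but not `e₂`»,
  `R` non-trivial) and `flowHyperplane_injective_of_isEdgeConnected_three`;
* **(1) ⇒ (3)** `exists_flowHyperplane_eq_of_not_isEdgeConnected_three` (a two-edge cut
  `{e₁, e₂}` forces `ω(e₁) = ±ω(e₂)` for every flow);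
* **Proposition 61 (1) ⇔ (3)** `flowHyperplane_injective_iff_isEdgeConnected_three`.
((2) ⇔ (3) is the lineage's `abelJacobi_injective_iff_isEdgeConnected`.)

One definition with body and theorems; no `sorry`; no named facts; no instances.
-/

open Finset SimpleGraph Matrix
open Literature.Combinatorics.SimpleGraph.ChipFiring
open Literature.Combinatorics.SimpleGraph.OrientedIncidence

namespace Literature.Combinatorics.SimpleGraph.BakerNorine

variable {V : Type*} [Fintype V] [DecidableEq V] (G : SimpleGraph V) [DecidableRel G.Adj]
variable (R : Type*) [CommRing R]

/-! ### §1 The hyperplanes `W(e)` -/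

/-- **`W(e) := {ω ∈ 𝓗¹(G) : ω(e) = 0}`**, the value of the canonical map `ψ_G` at the edge
`e = uv` (read on the dart `(u, v)`; independent of the orientation, `flowHyperplane_comm`).
[cite: BakerNorine2009, §5.4 (the canonical map `ψ_G`)] -/
def flowHyperplane (u v : V) : Set (V → V → R) := {ω | IsGraphFlow G ω ∧ ω u v = 0}

variable {G R}

omit [DecidableEq V] in
/-- Membership in `W(uv)`. [cite: BakerNorine2009, §5.4] -/
theorem mem_flowHyperplane {u v : V} {ω : V → V → R} :
    ω ∈ flowHyperplane G R u v ↔ IsGraphFlow G ω ∧ ω u v = 0 := Iff.rfl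

omit [DecidableEq V] in
/-- «The condition `ω(e) = 0` is independent of the orientation of `e`.»
[cite: BakerNorine2009, §5.4] -/
theorem flowHyperplane_comm (u v : V) : flowHyperplane G R u v = flowHyperplane G R v u := by
  ext ω
  rw [mem_flowHyperplane, mem_flowHyperplane]
  refine and_congr_right fun h => ?_
  rw [h.antisymm' u v, neg_eq_zero]

/-! ### §2 The net flow across a cut vanishes -/

/-- For a flow, the total over the darts entering any vertex set `S` from outside is `0` (sum
`δ(ω) = 0` over `S`; the darts inside `S` cancel in pairs). [cite: BakerNorine2009, Proposition 61
(proof of (1) ⇒ (3): «any flow […] which is non-zero on `e₁` must also be non-zero on `e₂`»)] -/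
theorem IsGraphFlow.sum_boundary_eq_zero {ω : V → V → R} (h : IsGraphFlow G ω) (S : Finset V) :
    ∑ x ∈ S, ∑ y ∈ (G.neighborFinset x).filter (fun y => y ∉ S), ω y x = 0 := by
  have h0 : ∑ x ∈ S, coboundary G ω x = 0 := sum_eq_zero fun x _ => h.coboundary_eq_zero x
  have hsplit : ∀ x ∈ S, coboundary G ω x =
      ∑ y ∈ S, ω y x + ∑ y ∈ (G.neighborFinset x).filter (fun y => y ∉ S), ω y x := by
    intro x _
    rw [coboundary_apply, ← sum_filter_add_sum_filter_not (G.neighborFinset x) (fun y => y ∈ S)]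
    congr 1
    refine sum_subset (fun y hy => (mem_filter.1 hy).2) fun y hyS hy => ?_
    exact h.eq_zero_of_not_adj fun hyx =>
      hy (mem_filter.2 ⟨(mem_neighborFinset _ _ _).2 hyx.symm, hyS⟩)
  rwa [sum_congr rfl hsplit, sum_add_distrib, sum_comm, h.toIsOneCochain.sum_sum_eq_zero S,
    zero_add] at h0

/-! ### §3 (3) ⇒ (1): a cycle through `e₁` avoiding `e₂` -/

omit [Fintype V] in
/-- `ofEdgeVec σ x` vanishes on the darts of an edge where `x` does.
[cite: BakerNorine2009, §4.3] -/
theorem ofEdgeVec_apply_eq_zero (σ : Orientation G) {x : G.edgeSet → R} {a b : V} (hab : G.Adj a b)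
    (hx : x ⟨s(a, b), hab⟩ = 0) : ofEdgeVec σ x a b = 0 := by
  by_cases hh : σ.head ⟨s(a, b), hab⟩ = b
  · rw [ofEdgeVec_apply_of_head_eq σ x hab hh, hx]
  · rw [ofEdgeVec_apply_of_head_ne σ x hab hh, hx, neg_zero]

/-- **(3) ⇒ (1), the flow**: in a 3-edge-connected graph, for edges `e₁ ≠ e₂` «there is a cycle `C`
containing `e₁` but not `e₂`», whose characteristic flow is «in `W(e₂)` but not `W(e₁)`».
[cite: BakerNorine2009, Proposition 61 (proof of (3) ⇒ (1))] -/
theorem exists_isGraphFlow_eq_zero_ne_zero [Nontrivial R] (h3 : G.IsEdgeConnected 3) {u v u' v' : V}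
    (huv : G.Adj u v) (huv' : G.Adj u' v') (hne : s(u, v) ≠ s(u', v')) :
    ∃ ω : V → V → R, IsGraphFlow G ω ∧ ω u' v' = 0 ∧ ω u v ≠ 0 := by
  classical
  -- `H = G − e₂` is 2-edge-connected, so `e₁` is not a bridge of `H` and lies on a cycle of `H`
  set H := G.deleteEdges {s(u', v')} with hH
  have hH2 : H.IsEdgeConnected 2 := (isEdgeConnected_add_one (k := 2) two_ne_zero).1 h3 _
  have he₁ : s(u, v) ∈ H.edgeSet := by
    rw [hH, edgeSet_deleteEdges]
    exact ⟨G.mem_edgeSet.2 huv, hne⟩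
  have hnb : ¬H.IsBridge s(u, v) := fun hb =>
    isBridge_iff.1 hb ((isEdgeConnected_two.1 hH2 s(u, v)) u v)
  rw [isBridge_iff_forall_cycle_notMem he₁] at hnb
  push Not at hnb
  obtain ⟨w, c, hc, hmem⟩ := hnb
  -- transfer the cycle to `G`; it avoids `e₂`
  have hcG : ∀ e ∈ c.edges, e ∈ G.edgeSet := fun e he =>
    edgeSet_mono (deleteEdges_le {s(u', v')}) (c.edges_subset_edgeSet he)
  set c' := c.transfer G hcG with hc'
  have hc'c : c'.IsCycle := hc.transfer hcG
  have hmem₁ : s(u, v) ∈ c'.edges := by rwa [hc', Walk.edges_transfer]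
  have hmem₂ : s(u', v') ∉ c'.edges := by
    rw [hc', Walk.edges_transfer]
    intro h
    have := c.edges_subset_edgeSet h
    rw [hH, edgeSet_deleteEdges] at this
    exact this.2 rfl
  set σ := someOrientation G
  refine ⟨ofEdgeVec σ (σ.walkVec R c'), isGraphFlow_ofEdgeVec_walkVec σ c', ?_, ?_⟩
  · exact ofEdgeVec_apply_eq_zero σ huv'
      (σ.walkVec_apply_of_not_mem_edges R c' (e := ⟨s(u', v'), huv'⟩) hmem₂)
  · exact ofEdgeVec_walkVec_apply_ne_zero σ hc'c.isTrail huv hmem₁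

/-- **(3) ⇒ (1)**: in a 3-edge-connected graph the canonical map is injective — edges with the
same hyperplane `W` coincide. [cite: BakerNorine2009, Proposition 61 ((3) ⇒ (1))] -/
theorem flowHyperplane_injective_of_isEdgeConnected_three [Nontrivial R]
    (h3 : G.IsEdgeConnected 3) {u v u' v' : V} (huv : G.Adj u v) (huv' : G.Adj u' v')
    (heq : flowHyperplane G R u v = flowHyperplane G R u' v') : s(u, v) = s(u', v') := by
  by_contra hne
  obtain ⟨ω, hω, h0, h1⟩ := exists_isGraphFlow_eq_zero_ne_zero (R := R) h3 huv huv' hne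
  have hmem : ω ∈ flowHyperplane G R u' v' := ⟨hω, h0⟩
  rw [← heq] at hmem
  exact h1 hmem.2

/-! ### §4 (1) ⇒ (3): a two-edge cut -/

omit [Fintype V] [DecidableEq V] [DecidableRel G.Adj] in
/-- A vertex set containing `a` and closed under the edges of `K` contains every vertex
`K`-reachable from `a`. [folklore] -/
private theorem mem_of_reachable_of_closed {K : SimpleGraph V} {S : Finset V}
    (hS : ∀ x ∈ S, ∀ y, K.Adj x y → y ∈ S) {a y : V} (ha : a ∈ S) (h : K.Reachable a y) :
    y ∈ S := by
  obtain ⟨p⟩ := h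
  revert ha
  induction p with
  | nil => exact id
  | cons hxy p ih => exact fun ha => ih (hS _ ha _ hxy)

/-- The boundary sum of §2 as a sum over the crossing darts `(x, y)`, `x ∈ S`, `y ∉ S`.
[cite: BakerNorine2009, Proposition 61 (proof of (1) ⇒ (3))] -/
private theorem sum_boundary_eq_sum_pairs (S : Finset V) (f : V → V → R) :
    ∑ x ∈ S, ∑ y ∈ (G.neighborFinset x).filter (fun y => y ∉ S), f y x =
      ∑ p ∈ (S ×ˢ univ).filter (fun p : V × V => p.2 ∉ S ∧ G.Adj p.1 p.2), f p.2 p.1 := by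
  rw [sum_filter, sum_product]
  refine sum_congr rfl fun x _ => ?_
  rw [← sum_filter]
  congr 1
  ext y
  simp only [mem_filter, mem_neighborFinset, mem_univ, true_and]
  exact and_comm

/-- **(1) ⇒ (3)** (contrapositive): if the 2-edge-connected graph `G` is not 3-edge-connected,
«there exist edges `e₁, e₂ ∈ E(G)` such that `G − {e₁, e₂}` is disconnected. It follows that any
flow `ω ∈ 𝓗¹(G)` which is non-zero on `e₁` must also be non-zero on `e₂`. Thus `W(e₁) = W(e₂)`»
(summing `δ(ω) = 0` over one side of the two-edge cut gives `ω(e₁) = ± ω(e₂)`).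
[cite: BakerNorine2009, Proposition 61 ((1) ⇒ (3))] -/
theorem exists_flowHyperplane_eq_of_not_isEdgeConnected_three (h2 : G.IsEdgeConnected 2)
    (h3 : ¬G.IsEdgeConnected 3) :
    ∃ u v u' v', G.Adj u v ∧ G.Adj u' v' ∧ s(u, v) ≠ s(u', v') ∧
      flowHyperplane G R u v = flowHyperplane G R u' v' := by
  classical
  -- a two-edge cut `{e₁, e₂}` separating `a` from `b`
  have h3' : ¬∀ e, (G.deleteEdges {e}).IsEdgeConnected 2 := fun h =>
    h3 ((isEdgeConnected_add_one (k := 2) two_ne_zero).2 h)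
  push Not at h3'
  obtain ⟨e₁, he₁⟩ := h3'
  rw [isEdgeConnected_two] at he₁
  push Not at he₁
  obtain ⟨e₂, he₂⟩ := he₁
  rw [deleteEdges_deleteEdges, Set.singleton_union] at he₂
  simp only [Preconnected, not_forall] at he₂
  obtain ⟨a, b, hab⟩ := he₂
  -- `S` = the vertices reachable from `a` in `G − {e₁, e₂}`
  set S : Finset V := univ.filter (fun x => (G.deleteEdges {e₁, e₂}).Reachable a x) with hS
  have hmemS : ∀ x, x ∈ S ↔ (G.deleteEdges {e₁, e₂}).Reachable a x := fun x => by
    rw [hS, mem_filter]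
    exact ⟨fun h => h.2, fun h => ⟨mem_univ _, h⟩⟩
  have haS : a ∈ S := (hmemS a).2 (Reachable.refl a)
  have hbS : b ∉ S := fun h => hab ((hmemS b).1 h)
  -- every edge leaving `S` is `e₁` or `e₂`
  have hcut : ∀ x ∈ S, ∀ y ∉ S, G.Adj x y → s(x, y) = e₁ ∨ s(x, y) = e₂ := by
    intro x hx y hy hxy
    by_contra hne
    push Not at hne
    refine hy ((hmemS y).2 (((hmemS x).1 hx).trans (Adj.reachable ?_)))
    rw [deleteEdges_adj]
    refine ⟨hxy, ?_⟩
    rw [Set.mem_insert_iff, Set.mem_singleton_iff]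
    push Not
    exact hne
  -- by 2-edge-connectivity the edges leaving `S` are not all equal to one edge `e`
  have hclosure : ∀ e : Sym2 V, (∀ x ∈ S, ∀ y ∉ S, G.Adj x y → s(x, y) = e) → False := by
    intro e hc
    have hcl : ∀ x ∈ S, ∀ y, (G.deleteEdges {e}).Adj x y → y ∈ S := by
      intro x hx y hxy
      rw [deleteEdges_adj, Set.mem_singleton_iff] at hxy
      by_contra hy
      exact hxy.2 (hc x hx y hy hxy.1)
    exact hbS (mem_of_reachable_of_closed hcl haS ((isEdgeConnected_two.1 h2 e) a b))
  -- so both `e₁` and `e₂` leave `S`, and they are distinct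
  obtain ⟨x₁, hx₁, y₁, hy₁, had₁, he₁'⟩ : ∃ x ∈ S, ∃ y ∉ S, G.Adj x y ∧ s(x, y) = e₁ := by
    by_contra hno
    push Not at hno
    exact hclosure e₂ fun x hx y hy hxy => (hcut x hx y hy hxy).resolve_left (hno x hx y hy hxy)
  obtain ⟨x₂, hx₂, y₂, hy₂, had₂, he₂'⟩ : ∃ x ∈ S, ∃ y ∉ S, G.Adj x y ∧ s(x, y) = e₂ := by
    by_contra hno
    push Not at hno
    exact hclosure e₁ fun x hx y hy hxy => (hcut x hx y hy hxy).resolve_right (hno x hx y hy hxy)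
  have hne : s(x₁, y₁) ≠ s(x₂, y₂) := by
    rw [he₁', he₂']
    intro heq
    exact hclosure e₁ fun x hx y hy hxy =>
      (hcut x hx y hy hxy).elim id (fun h => h.trans heq.symm)
  -- the crossing darts are exactly `(x₁, y₁)` and `(x₂, y₂)`
  have hP : (S ×ˢ univ).filter (fun p : V × V => p.2 ∉ S ∧ G.Adj p.1 p.2) =
      {(x₁, y₁), (x₂, y₂)} := by
    ext p
    simp only [mem_filter, mem_product, mem_univ, and_true, mem_insert, mem_singleton]
    constructor
    · rintro ⟨hp1, hp2, hadj⟩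
      rcases hcut p.1 hp1 p.2 hp2 hadj with h | h
      · rw [← he₁', Sym2.eq_iff] at h
        rcases h with ⟨h1, h2'⟩ | ⟨h1, _⟩
        · exact Or.inl (Prod.ext h1 h2')
        · exact absurd (h1 ▸ hp1) hy₁
      · rw [← he₂', Sym2.eq_iff] at h
        rcases h with ⟨h1, h2'⟩ | ⟨h1, _⟩
        · exact Or.inr (Prod.ext h1 h2')
        · exact absurd (h1 ▸ hp1) hy₂
    · rintro (rfl | rfl)
      · exact ⟨hx₁, hy₁, had₁⟩
      · exact ⟨hx₂, hy₂, had₂⟩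
  have hpne : ((x₁, y₁) : V × V) ≠ (x₂, y₂) := fun h => by
    obtain ⟨h1, h2'⟩ := Prod.mk.injEq _ _ _ _ ▸ h
    exact hne (by rw [h1, h2'])
  -- hence `ω(y₁, x₁) + ω(y₂, x₂) = 0` for every flow
  have hsum : ∀ ω : V → V → R, IsGraphFlow G ω → ω y₁ x₁ + ω y₂ x₂ = 0 := by
    intro ω hω
    have h := hω.sum_boundary_eq_zero S
    rwa [sum_boundary_eq_sum_pairs, hP, sum_pair hpne] at h
  refine ⟨x₁, y₁, x₂, y₂, had₁, had₂, hne, ?_⟩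
  ext ω
  rw [mem_flowHyperplane, mem_flowHyperplane]
  refine and_congr_right fun hω => ?_
  have h := hsum ω hω
  rw [hω.antisymm' x₁ y₁, hω.antisymm' x₂ y₂] at h
  constructor
  · intro h1
    rwa [h1, neg_zero, zero_add, neg_eq_zero] at h
  · intro h2'
    rwa [h2', neg_zero, add_zero, neg_eq_zero] at h

/-! ### §5 Proposition 61 (1) ⇔ (3) -/

/-- **Proposition 61 (1) ⇔ (3)**: for a 2-edge-connected graph, the canonical map `e ↦ W(e)` is
injective iff `G` is 3-edge-connected (flows with values in a non-trivial commutative ring, e.g.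
`ℝ`). [cite: BakerNorine2009, Proposition 61] -/
theorem flowHyperplane_injective_iff_isEdgeConnected_three [Nontrivial R]
    (h2 : G.IsEdgeConnected 2) :
    (∀ u v u' v', G.Adj u v → G.Adj u' v' →
        flowHyperplane G R u v = flowHyperplane G R u' v' → s(u, v) = s(u', v')) ↔
      G.IsEdgeConnected 3 := by
  constructor
  · intro h
    by_contra h3
    obtain ⟨u, v, u', v', huv, huv', hne, heq⟩ :=
      exists_flowHyperplane_eq_of_not_isEdgeConnected_three (R := R) h2 h3
    exact hne (h u v u' v' huv huv' heq)
  · intro h3 u v u' v' huv huv' heq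
    exact flowHyperplane_injective_of_isEdgeConnected_three h3 huv huv' heq

end Literature.Combinatorics.SimpleGraph.BakerNorine
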